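import Summits.QuantumFields.YangMills.Theses.ContractibleFibre

/-!
# Birth skeleton (BC3) for crux `FibreToTorus` (stmt-QuantumFields-16244) — `Lines/birth.lean`

Registrar: `planner-skel-stmt-QuantumFields-16244-0` (skeleton-register one-shot; route
`route-QuantumFields-ContractibleFibre`, rank-4 crux, re-audit bin REPAIRABLE), 2026-08-17.
Namespace `Summit.QuantumFields.YangMills.Cruxes.FibreToTorus.Birth`; imports only the route file.

## The crux (route file `Theses/ContractibleFibre.lean`, decl
`Summit.QuantumFields.YangMills.Theses.ContractibleFibre.FibreToTorus`, "FREE TUBES ⇒ SYMMETRIC TORUS")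

For every compact simple `G` (Borel σ-algebra put on `G` by `letI := borel G`) and every faithful unitary
lattice representation `r`: IF there is `β₁` such that for every `β ≥ β₁` ONE rate `m(β) > 0` and, per slab
width `w`, ONE constant `C` uniform in the fibre width `M` cluster in Euclidean time all bounded measurable
time-slab observables on the FREE TUBES `(ℤ/L)²×{0..M}²` of every width (`L ≥ L_min(β,M,w)`, `2n < L`; the
crux's inline predicate `Tube M β m C w Lmin` — verbatim the conclusion of `FibreContinuity`), THEN the
`UniformLatticeGap` body holds for `r`: `β₀`, and for `β ≥ β₀` a rate `m > 0` and `S₁` with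
`|latticeConnectedCorr r.ρ β (2S+1) A.F B.F n| ≤ C(A,B) e^{−m n}` for all `A B : YMSpecies G`, `S ≥ S₁`, `n ≤ S`.

## The cut: thermodynamic limit → phase identification → vacuum dominance

The route's intended proof (item docstring; confirmed piece by piece by the route review on this item,
refuter note 2026-08-16: "(i) M,L→∞ along the floors gives free-tube thermodynamic-limit states on ℤ⁴ …
(ii) identification with periodic-torus states on LOCAL gauge-invariant observables at WEAK coupling — itself a
b.c.-insensitivity/Gibbs-uniqueness-type statement, open in d=4 at large β … (iii) S-uniform constants on
(2S+1)⁴ for n ≤ S need vacuum dominance") passes through TWO infinite-volume objects the tree already has —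
the DLR states `ymGibbsMeasures r.ρ β` of the Wilson specification on `ℤ⁴` and the periodic limit points
`infiniteVolumeLimitPoints r.ρ β` of the symmetric-torus Wilson states (`Literature…QuantumLattice.LatticeGaugeDLR`)
— so the skeleton cuts the crux exactly there, into three implications chained by pure logic:

* `stub_tubeThermodynamicLimit` (T, size M–L, group-blind): at ONE coupling `β` and rate `m > 0`, the `M`-uniform
  free-tube family (`∀ w ∃ C ∀ M ∃ L_min, Tube M β m C w L_min`, the crux's predicate verbatim) ⇒ there is a DLR
  state `μ ∈ ymGibbsMeasures r.ρ β` clustering in time at the SAME rate `m` on all gauge-invariant local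
  observables, `|μ[A·τₙB] − μ[A]μ[τₙB]| ≤ C(A,B) e^{−mn}` (`τₙ = configShift (−n e₀)`, the convention of
  `latticeConnectedCorr`).  Content: centred fibre boxes `M_k, L_k → ∞` along the floors; compactness of
  `G^{edges}` upgraded to total-variation compactness of finite-edge marginals (equicontinuous finite-range DLR
  densities — needed because `YMSpecies` are bounded MEASURABLE, not continuous); free-boundary finite-volume
  Gibbs states ⇒ DLR in the limit (Georgii Thm. 4.17 shape; cf. the tree's named fact
  `mem_ymGibbsMeasures_of_mem_infiniteVolumeLimitPoints` for the periodic analogue); the `M`-uniform bounds pass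
  to the limit.
* `stub_phaseIdentification` (P, the crux's own why-might-fail ISOLATED, size L / open at weak coupling): IF at
  every `β ≥ β₂` SOME DLR state clusters exponentially in time on gauge-invariant local observables, THEN there is
  `β₃` such that at every `β ≥ β₃` one rate `m > 0` clusters EVERY periodic limit point
  `μ ∈ infiniteVolumeLimitPoints r.ρ β`, constants `C(A,B)` uniform over the limit points — free = periodic on
  gauge invariants at weak coupling (b.c.-insensitivity far from the free faces, Lüscher–Schaefer open-boundary
  zone; Gibbs uniqueness on the gauge-invariant algebra at large `β`).
* `stub_vacuumDominance` (V, size L): IF at every `β ≥ β₃` one rate clusters every periodic limit point (output of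
  (P)), THEN the crux's conclusion for `r` (the `UniformLatticeGap` body, verbatim): finite symmetric tori
  `(2S+1)⁴`, `n ≤ S`, constants uniform in `S` — transfer-matrix vacuum dominance (wrap-around terms
  `e^{−m(2S+1−n)}`, multiplicity/entropy of states, finite-size mass shifts; the 2001 `ym-w-vdom`/`ym-w-pingap`
  passage rows).
* `FibreToTorus_of : (T) → (P) → (V) → FibreToTorus` — PROVED below without `sorry` (pure logic: `letI := borel G`;
  `β₁` from the crux hypothesis; (T) at each `β ≥ β₁` with the tube rate `m(β)`; (P) at threshold `β₁`; (V) at the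
  resulting `β₃`).  Hypotheses are spelled `__Registered.stub_X` (`rfl`-aliases keyed by the stub names, for the
  native audit `#h21_check_skeleton`); it concludes the route decl BY NAME; the closing `example` instantiates it
  with the three stubs by name (kernel-checked signature match).

No stub is the crux or the summit in costume: (T) ends in infinite volume (no torus, no `S`-uniformity), (P) and
(V) are implications between infinite-volume / finite-volume clustering statements with substantive antecedents
and never see a free tube; the cheap probes `stub → FibreToTorus` and `stub → YangMills` fail for all three
(registrar folder `bc/`, record in `Lines/birth.md`).  Typing checklist: every `∫` is a Bochner integral of a
bounded measurable function (`YMSpecies` carry `measurable`/`bounded`; CRUX TYPING CHECKLIST (ii)); `β`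
conventions agree (torus `exp(−β Σₚ(N − Re tr ρU_p))`, DLR tilt `−β·wilsonBoundaryAction`, tube
`exp(β Σ ins·Re tr r.ρ U_P)`: the same Boltzmann factor up to constants); stubs take `[MeasurableSpace G]
[BorelSpace G]` binders (instantiated at `borel G` in the composition), as the `WeakCouplingLatticeGap` birth
skeleton does.

## Disproof used / junk audit

None exists: `ledger crux ls stmt-QuantumFields-16244` showed no workfiles before this one (no `Disproof.lean`, no
`Theorems/FibreToTorus/Negative/`); `ledger negatives --problem QuantumFields` (5 entries: NestedDissectionSea
RobustYangMillsRG, MirrorModularBoosts DiagonalMirrorRP, AdaptiveBlockFermions, MultibosonBridge ×2) has no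
clustering / DLR / boundary-condition statement.  By hand: `β = 0` (independent Haar links) satisfies the tube
family for every `m > 0` and (T)'s conclusion with `μ` = product Haar (the DLR state at `β = 0`; connected
correlations vanish beyond the supports) — no degenerate refutation; (P)/(V) choose their own thresholds, so
small `β` is immaterial; the hypothesis of (V) is not vacuous (`infiniteVolumeLimitPoints` is non-empty by
compactness, tree fact `infiniteVolumeLimitPoints_nonempty`, proved as `infiniteVolumeLimitPoints_nonempty_holds`), nor is that of (P) (`IsGibbsMeasure` includes
`IsProbabilityMeasure`, so the zero measure does not qualify); `U(1)` is outside every stub by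
`IsCompactSimpleLieGroup`, and for it the tube family hypothesis fails anyway (free photon), which is where the
route puts the group-sensitivity (`FibreContinuity`), not here.
-/

noncomputable section

namespace Summit.QuantumFields.YangMills.Cruxes.FibreToTorus.Birth

open scoped BigOperators Topology Manifold Classical MeasureTheory ProbabilityTheory Matrix InnerProductSpace ComplexConjugate ContinuousMap
open Filter Set Function TopologicalSpace MeasureTheory
open Literature.MathematicalPhysics.QuantumFieldTheory
open Literature.MathematicalPhysics.QuantumLattice (LGConfig configShift ymGibbsMeasures infiniteVolumeLimitPoints)

/-! ## The three stub STATEMENTS (named `Prop`s; the registered stubs below repeat them verbatim) -/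

/-- **(T) Thermodynamic limit of the free tubes — statement.** For every compact simple `G`, every faithful
unitary lattice representation `r`, every coupling `β` and rate `m > 0`: IF the free tubes `(ℤ/L)²×{0..M}²` of
EVERY fibre width `M` cluster in time at rate `m` with slab-width constants `C(w)` UNIFORM in `M` on all
`L ≥ L_min(M, w)` (verbatim the crux's inline predicate `Tube`, i.e. one `β`-slice of the conclusion of
`FibreContinuity`), THEN there is an infinite-volume lattice Yang–Mills DLR state `μ ∈ ymGibbsMeasures r.ρ β` on
`ℤ⁴` (a probability measure satisfying the DLR equations of the Wilson specification) which clusters in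
Euclidean time at the SAME rate `m` on all gauge-invariant local observables `A B : YMSpecies G`:
`|μ[A · τₙB] − μ[A] μ[τₙB]| ≤ C(A,B) e^{−m n}` for all `n` (`τₙ = configShift (−n e₀)`).  Intended proof:
`M_k, L_k → ∞` along the floors, centred fibre boxes, compactness of `G^{edges}` with total-variation
compactness of the finite-edge marginals (equicontinuous DLR densities), free-boundary finite-volume Gibbs
states ⇒ DLR in the limit (Georgii Thm. 4.17 shape), and the `M`-uniform bounds pass to the limit. -/
def TubeThermodynamicLimit : Prop :=
  ∀ (G : Type) [Group G] [TopologicalSpace G] [IsTopologicalGroup G] [CompactSpace G]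
    [MeasurableSpace G] [BorelSpace G], IsCompactSimpleLieGroup G → ∀ r : LatticeRep G,
    let Tube := fun (M : ℕ) (β m C : ℝ) (w Lmin : ℕ) => ∀ (L : ℕ) [NeZero L], Lmin ≤ L →
      let St := ZMod L × ZMod L × Fin (M + 1) × Fin (M + 1);
      let Cfg := St × Fin 4 → G;
      let ν : MeasureTheory.Measure Cfg := MeasureTheory.Measure.pi fun _ => haarProbability G;
      let sh : St → Fin 4 → St := fun x μ => ![(x.1 + 1, x.2.1, x.2.2.1, x.2.2.2), (x.1, x.2.1 + 1, x.2.2.1, x.2.2.2), (x.1, x.2.1, x.2.2.1 + 1, x.2.2.2), (x.1, x.2.1, x.2.2.1, x.2.2.2 + 1)] μ;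
      let ins : St → Fin 4 → Fin 4 → ℝ := fun x μ κ => if ((μ = 2 ∨ κ = 2) → (x.2.2.1 : ℕ) < M) ∧ ((μ = 3 ∨ κ = 3) → (x.2.2.2 : ℕ) < M) then 1 else 0;
      let pl : Cfg → St → Fin 4 → Fin 4 → G := fun U x μ κ => U (x, μ) * U (sh x μ, κ) * (U (sh x κ, μ))⁻¹ * (U (x, κ))⁻¹;
      let act : Cfg → ℝ := fun U => β * ∑ x : St, ∑ q : {q : Fin 4 × Fin 4 // q.1 < q.2}, ins x q.1.1 q.1.2 * (r.ρ (pl U x q.1.1 q.1.2)).trace.re;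
      let wgt : Cfg → ℝ := fun U => Real.exp (act U);
      let Ex : (Cfg → ℝ) → ℝ := fun F => (∫ U, F U * wgt U ∂ν) / (∫ U, wgt U ∂ν);
      let σ : ℕ → Cfg → Cfg := fun n U p => U ((p.1.1 + n, p.1.2), p.2);
      ∀ c : ZMod L,
      let Loc := fun F : Cfg → ℝ => Measurable F ∧ (∀ U, |F U| ≤ 1) ∧ ∀ U U', (∀ p : St × Fin 4, (p.1.1 - c).val ≤ w → U p = U' p) → F U = F U';
      ∀ F₁ F₂ : Cfg → ℝ, Loc F₁ → Loc F₂ → ∀ n : ℕ, 2 * n < L → |Ex (fun U => F₁ U * F₂ (σ n U)) - Ex F₁ * Ex (fun U => F₂ (σ n U))| ≤ C * Real.exp (-(m * n));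
    ∀ (β m : ℝ), 0 < m → (∀ w : ℕ, ∃ C : ℝ, ∀ M : ℕ, ∃ Lmin : ℕ, Tube M β m C w Lmin) →
      ∃ μ : MeasureTheory.Measure (LGConfig 4 G), μ ∈ ymGibbsMeasures (d := 4) r.ρ β ∧
        ∀ A B : YMSpecies G, ∃ C : ℝ, ∀ n : ℕ,
          |(∫ U, A.F U * B.F (configShift (-Pi.single 0 (n : ℤ)) U) ∂μ) -
              (∫ U, A.F U ∂μ) * (∫ U, B.F (configShift (-Pi.single 0 (n : ℤ)) U) ∂μ)| ≤
            C * Real.exp (-(m * n))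

/-- **(P) Phase identification: free = periodic at weak coupling — statement.** For every compact simple `G`,
faithful unitary `r` and threshold `β₂`: IF at every `β ≥ β₂` SOME DLR state `μ ∈ ymGibbsMeasures r.ρ β`
clusters exponentially in time on gauge-invariant local observables (the output of (T)), THEN there is `β₃`
such that at every `β ≥ β₃` ONE rate `m > 0` clusters EVERY periodic infinite-volume limit point
`μ ∈ infiniteVolumeLimitPoints r.ρ β` (subsequential limits of the symmetric-torus Wilson states) on
gauge-invariant local observables, with constants `C(A,B)` uniform over the limit points.  This is the
boundary-condition-insensitivity / Gibbs-uniqueness-on-gauge-invariants input at WEAK coupling (the crux's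
own why-might-fail, isolated): the phase seen from free tubes is the phase seen from periodic tori. -/
def PhaseIdentification : Prop :=
  ∀ (G : Type) [Group G] [TopologicalSpace G] [IsTopologicalGroup G] [CompactSpace G]
    [MeasurableSpace G] [BorelSpace G], IsCompactSimpleLieGroup G → ∀ (r : LatticeRep G) (β₂ : ℝ),
    (∀ β : ℝ, β₂ ≤ β → ∃ m : ℝ, 0 < m ∧
      ∃ μ : MeasureTheory.Measure (LGConfig 4 G), μ ∈ ymGibbsMeasures (d := 4) r.ρ β ∧
        ∀ A B : YMSpecies G, ∃ C : ℝ, ∀ n : ℕ,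
          |(∫ U, A.F U * B.F (configShift (-Pi.single 0 (n : ℤ)) U) ∂μ) -
              (∫ U, A.F U ∂μ) * (∫ U, B.F (configShift (-Pi.single 0 (n : ℤ)) U) ∂μ)| ≤
            C * Real.exp (-(m * n))) →
    ∃ β₃ : ℝ, ∀ β : ℝ, β₃ ≤ β → ∃ m : ℝ, 0 < m ∧
      ∀ A B : YMSpecies G, ∃ C : ℝ, ∀ μ : MeasureTheory.Measure (LGConfig 4 G),
        μ ∈ infiniteVolumeLimitPoints (d := 4) r.ρ β → ∀ n : ℕ,
          |(∫ U, A.F U * B.F (configShift (-Pi.single 0 (n : ℤ)) U) ∂μ) -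
              (∫ U, A.F U ∂μ) * (∫ U, B.F (configShift (-Pi.single 0 (n : ℤ)) U) ∂μ)| ≤
            C * Real.exp (-(m * n))

/-- **(V) Vacuum dominance: infinite volume ⇒ symmetric torus with `S`-uniform constants — statement.** For
every compact simple `G`, faithful unitary `r` and threshold `β₃`: IF at every `β ≥ β₃` one rate `m > 0`
clusters every periodic infinite-volume limit point on gauge-invariant local observables (the output of (P)),
THEN the crux's conclusion holds for `r` — the `UniformLatticeGap` body: `β₀`, and for `β ≥ β₀` a rate
`m > 0` and `S₁` with `|latticeConnectedCorr r.ρ β (2S+1) A.F B.F n| ≤ C(A,B) e^{−m n}` for all `S ≥ S₁`,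
`n ≤ S` (finite symmetric tori `(2S+1)⁴`, constants uniform in `S`: transfer-matrix vacuum dominance for
`n ≤ S`, wrap-around terms `e^{−m(2S+1−n)}`, finite-size mass shifts; the 2001 `ym-w-vdom` / `ym-w-pingap`
passage rows). -/
def VacuumDominance : Prop :=
  ∀ (G : Type) [Group G] [TopologicalSpace G] [IsTopologicalGroup G] [CompactSpace G]
    [MeasurableSpace G] [BorelSpace G], IsCompactSimpleLieGroup G → ∀ (r : LatticeRep G) (β₃ : ℝ),
    (∀ β : ℝ, β₃ ≤ β → ∃ m : ℝ, 0 < m ∧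
      ∀ A B : YMSpecies G, ∃ C : ℝ, ∀ μ : MeasureTheory.Measure (LGConfig 4 G),
        μ ∈ infiniteVolumeLimitPoints (d := 4) r.ρ β → ∀ n : ℕ,
          |(∫ U, A.F U * B.F (configShift (-Pi.single 0 (n : ℤ)) U) ∂μ) -
              (∫ U, A.F U ∂μ) * (∫ U, B.F (configShift (-Pi.single 0 (n : ℤ)) U) ∂μ)| ≤
            C * Real.exp (-(m * n))) →
    ∃ β₀ : ℝ, ∀ β : ℝ, β₀ ≤ β → ∃ m : ℝ, 0 < m ∧ ∃ S₁ : ℕ, ∀ A B : YMSpecies G, ∃ C : ℝ,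
      ∀ S n : ℕ, S₁ ≤ S → n ≤ S →
        |latticeConnectedCorr r.ρ β (2 * S + 1) A.F B.F n| ≤ C * Real.exp (-(m * n))

/-! ## The three REGISTERED STUBS (the ONLY `sorry`s of this file; signatures = the statements above, verbatim) -/

/-- Registered stub `stub_tubeThermodynamicLimit` : the statement `TubeThermodynamicLimit` written out (BC3: a genuine lemma of the line,
stated over existing declarations; proved later under `Theorems/` and landed `--supports stmt-QuantumFields-16244`). -/
theorem stub_tubeThermodynamicLimit :
    ∀ (G : Type) [Group G] [TopologicalSpace G] [IsTopologicalGroup G] [CompactSpace G]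
      [MeasurableSpace G] [BorelSpace G], IsCompactSimpleLieGroup G → ∀ r : LatticeRep G,
      let Tube := fun (M : ℕ) (β m C : ℝ) (w Lmin : ℕ) => ∀ (L : ℕ) [NeZero L], Lmin ≤ L →
        let St := ZMod L × ZMod L × Fin (M + 1) × Fin (M + 1);
        let Cfg := St × Fin 4 → G;
        let ν : MeasureTheory.Measure Cfg := MeasureTheory.Measure.pi fun _ => haarProbability G;
        let sh : St → Fin 4 → St := fun x μ => ![(x.1 + 1, x.2.1, x.2.2.1, x.2.2.2), (x.1, x.2.1 + 1, x.2.2.1, x.2.2.2), (x.1, x.2.1, x.2.2.1 + 1, x.2.2.2), (x.1, x.2.1, x.2.2.1, x.2.2.2 + 1)] μ;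
        let ins : St → Fin 4 → Fin 4 → ℝ := fun x μ κ => if ((μ = 2 ∨ κ = 2) → (x.2.2.1 : ℕ) < M) ∧ ((μ = 3 ∨ κ = 3) → (x.2.2.2 : ℕ) < M) then 1 else 0;
        let pl : Cfg → St → Fin 4 → Fin 4 → G := fun U x μ κ => U (x, μ) * U (sh x μ, κ) * (U (sh x κ, μ))⁻¹ * (U (x, κ))⁻¹;
        let act : Cfg → ℝ := fun U => β * ∑ x : St, ∑ q : {q : Fin 4 × Fin 4 // q.1 < q.2}, ins x q.1.1 q.1.2 * (r.ρ (pl U x q.1.1 q.1.2)).trace.re;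
        let wgt : Cfg → ℝ := fun U => Real.exp (act U);
        let Ex : (Cfg → ℝ) → ℝ := fun F => (∫ U, F U * wgt U ∂ν) / (∫ U, wgt U ∂ν);
        let σ : ℕ → Cfg → Cfg := fun n U p => U ((p.1.1 + n, p.1.2), p.2);
        ∀ c : ZMod L,
        let Loc := fun F : Cfg → ℝ => Measurable F ∧ (∀ U, |F U| ≤ 1) ∧ ∀ U U', (∀ p : St × Fin 4, (p.1.1 - c).val ≤ w → U p = U' p) → F U = F U';
        ∀ F₁ F₂ : Cfg → ℝ, Loc F₁ → Loc F₂ → ∀ n : ℕ, 2 * n < L → |Ex (fun U => F₁ U * F₂ (σ n U)) - Ex F₁ * Ex (fun U => F₂ (σ n U))| ≤ C * Real.exp (-(m * n));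
      ∀ (β m : ℝ), 0 < m → (∀ w : ℕ, ∃ C : ℝ, ∀ M : ℕ, ∃ Lmin : ℕ, Tube M β m C w Lmin) →
        ∃ μ : MeasureTheory.Measure (LGConfig 4 G), μ ∈ ymGibbsMeasures (d := 4) r.ρ β ∧
          ∀ A B : YMSpecies G, ∃ C : ℝ, ∀ n : ℕ,
            |(∫ U, A.F U * B.F (configShift (-Pi.single 0 (n : ℤ)) U) ∂μ) -
                (∫ U, A.F U ∂μ) * (∫ U, B.F (configShift (-Pi.single 0 (n : ℤ)) U) ∂μ)| ≤
              C * Real.exp (-(m * n)) := by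
  sorry

/-- Registered stub `stub_phaseIdentification` : the statement `PhaseIdentification` written out (BC3: a genuine lemma of the line,
stated over existing declarations; proved later under `Theorems/` and landed `--supports stmt-QuantumFields-16244`). -/
theorem stub_phaseIdentification :
    ∀ (G : Type) [Group G] [TopologicalSpace G] [IsTopologicalGroup G] [CompactSpace G]
      [MeasurableSpace G] [BorelSpace G], IsCompactSimpleLieGroup G → ∀ (r : LatticeRep G) (β₂ : ℝ),
      (∀ β : ℝ, β₂ ≤ β → ∃ m : ℝ, 0 < m ∧
        ∃ μ : MeasureTheory.Measure (LGConfig 4 G), μ ∈ ymGibbsMeasures (d := 4) r.ρ β ∧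
          ∀ A B : YMSpecies G, ∃ C : ℝ, ∀ n : ℕ,
            |(∫ U, A.F U * B.F (configShift (-Pi.single 0 (n : ℤ)) U) ∂μ) -
                (∫ U, A.F U ∂μ) * (∫ U, B.F (configShift (-Pi.single 0 (n : ℤ)) U) ∂μ)| ≤
              C * Real.exp (-(m * n))) →
      ∃ β₃ : ℝ, ∀ β : ℝ, β₃ ≤ β → ∃ m : ℝ, 0 < m ∧
        ∀ A B : YMSpecies G, ∃ C : ℝ, ∀ μ : MeasureTheory.Measure (LGConfig 4 G),
          μ ∈ infiniteVolumeLimitPoints (d := 4) r.ρ β → ∀ n : ℕ,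
            |(∫ U, A.F U * B.F (configShift (-Pi.single 0 (n : ℤ)) U) ∂μ) -
                (∫ U, A.F U ∂μ) * (∫ U, B.F (configShift (-Pi.single 0 (n : ℤ)) U) ∂μ)| ≤
              C * Real.exp (-(m * n)) := by
  sorry

/-- Registered stub `stub_vacuumDominance` : the statement `VacuumDominance` written out (BC3: a genuine lemma of the line,
stated over existing declarations; proved later under `Theorems/` and landed `--supports stmt-QuantumFields-16244`). -/
theorem stub_vacuumDominance :
    ∀ (G : Type) [Group G] [TopologicalSpace G] [IsTopologicalGroup G] [CompactSpace G]
      [MeasurableSpace G] [BorelSpace G], IsCompactSimpleLieGroup G → ∀ (r : LatticeRep G) (β₃ : ℝ),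
      (∀ β : ℝ, β₃ ≤ β → ∃ m : ℝ, 0 < m ∧
        ∀ A B : YMSpecies G, ∃ C : ℝ, ∀ μ : MeasureTheory.Measure (LGConfig 4 G),
          μ ∈ infiniteVolumeLimitPoints (d := 4) r.ρ β → ∀ n : ℕ,
            |(∫ U, A.F U * B.F (configShift (-Pi.single 0 (n : ℤ)) U) ∂μ) -
                (∫ U, A.F U ∂μ) * (∫ U, B.F (configShift (-Pi.single 0 (n : ℤ)) U) ∂μ)| ≤
              C * Real.exp (-(m * n))) →
      ∃ β₀ : ℝ, ∀ β : ℝ, β₀ ≤ β → ∃ m : ℝ, 0 < m ∧ ∃ S₁ : ℕ, ∀ A B : YMSpecies G, ∃ C : ℝ,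
        ∀ S n : ℕ, S₁ ≤ S → n ≤ S →
          |latticeConnectedCorr r.ρ β (2 * S + 1) A.F B.F n| ≤ C * Real.exp (-(m * n)) := by
  sorry

/-! ## Signature match (kernel-checked): each registered stub IS its named statement -/

example : TubeThermodynamicLimit := stub_tubeThermodynamicLimit
example : PhaseIdentification := stub_phaseIdentification
example : VacuumDominance := stub_vacuumDominance

/-! ## Name-keyed aliases of the stub statements — the hypotheses of `FibreToTorus_of`

The native skeleton audit (`#h21_check_skeleton`) admits a `Prop` hypothesis of the skeleton theorem only if its
head constant is a registered obligation or is NAMED like a declared stub; `__Registered.stub_X` is the statement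
of `stub_X` under that name (device of the earlier `Lines/birth.lean` files).  Each alias is `rfl`-equal to its
statement. -/
namespace __Registered

/-- Alias of `TubeThermodynamicLimit` keyed by the registered stub name. -/
abbrev stub_tubeThermodynamicLimit : Prop := TubeThermodynamicLimit
/-- Alias of `PhaseIdentification` keyed by the registered stub name. -/
abbrev stub_phaseIdentification : Prop := PhaseIdentification
/-- Alias of `VacuumDominance` keyed by the registered stub name. -/
abbrev stub_vacuumDominance : Prop := VacuumDominance

end __Registered

/-! ## Composition: the crux BY NAME from the three stub statements (no `sorry` below this line) -/

/-- **`FibreToTorus_of : (T) → (P) → (V) → FibreToTorus`** — fix `G`, `hG`, `r`, put the Borel σ-algebra on `G`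
exactly as the crux does (`letI := borel G`); the crux hypothesis gives `β₁` and, at each `β ≥ β₁`, a rate
`m > 0` with the `M`-uniform free-tube family, which (T) turns into an exponentially clustering DLR state at
rate `m`; (P) at threshold `β₁` gives `β₃` and the clustering of all periodic limit points; (V) at `β₃` is the
crux's conclusion for `r`.  Pure logic; conclusion = the route decl, by name. -/
theorem FibreToTorus_of (hT : __Registered.stub_tubeThermodynamicLimit)
    (hP : __Registered.stub_phaseIdentification) (hV : __Registered.stub_vacuumDominance) :
    Summit.QuantumFields.YangMills.Theses.ContractibleFibre.FibreToTorus := by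
  intro G _ _ _ _ hG r Tube hfam
  letI : MeasurableSpace G := borel G
  haveI : BorelSpace G := ⟨rfl⟩
  obtain ⟨β₁, hβ₁⟩ := hfam
  -- (T): at every β ≥ β₁ an exponentially time-clustering DLR state on ℤ⁴, at the tube rate m(β)
  have hDLR : ∀ β : ℝ, β₁ ≤ β → ∃ m : ℝ, 0 < m ∧
      ∃ μ : MeasureTheory.Measure (LGConfig 4 G), μ ∈ ymGibbsMeasures (d := 4) r.ρ β ∧
        ∀ A B : YMSpecies G, ∃ C : ℝ, ∀ n : ℕ,
          |(∫ U, A.F U * B.F (configShift (-Pi.single 0 (n : ℤ)) U) ∂μ) -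
            (∫ U, A.F U ∂μ) * (∫ U, B.F (configShift (-Pi.single 0 (n : ℤ)) U) ∂μ)| ≤
          C * Real.exp (-(m * n)) := by
    intro β hβ
    obtain ⟨m, hm, hfamβ⟩ := hβ₁ β hβ
    exact ⟨m, hm, hT G hG r β m hm hfamβ⟩
  -- (P): free = periodic at weak coupling
  obtain ⟨β₃, hβ₃⟩ := hP G hG r β₁ hDLR
  -- (V): infinite volume ⇒ symmetric torus, S-uniform constants
  exact hV G hG r β₃ hβ₃

/-- **Registered instantiation (kernel-checked)**: the three stubs BY NAME give the crux BY NAME. -/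
example : Summit.QuantumFields.YangMills.Theses.ContractibleFibre.FibreToTorus :=
  FibreToTorus_of stub_tubeThermodynamicLimit stub_phaseIdentification stub_vacuumDominance

end Summit.QuantumFields.YangMills.Cruxes.FibreToTorus.Birth

end
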